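/-
Copyright (c) 2026 the pub-hodgecm-mathlib formalisation cell (harness21).  Prover seat hodgecm-mathlib-A-p03 (g24); LEAD F0P3a-plan (g9) WORD T8-41 «(F4)–(F8) PEN 1»,
architect A-p06 (g26) (MAP v3 §2 (F4)), 2026-09-01.
-/
import Literature.NumberTheory.Rogawski1990.UnitOrbitalIntegralInertCountJPos
import Literature.NumberTheory.Automorphic.UnitaryThreePHTowerPackage
import HarnessLib

/-!
# Flicker's PROPOSITION 10, closed form: the `P_H`-coset count of `τ_j` equals `iTen q ν N₊ m` (Prop. 8's numbers discharged)

Topic `NumberTheory/Rogawski1990` (road «D-N7-inert», MAP v3 (F4)); namespace `Literature.NumberTheory.Automorphic.UnitaryGroup`.  THEOREMS ONLY: no definition, no named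
fact, no instance, no notation, no `sorry`; kernel lane.

★ `natCard_cosets_eq_iTen` (p841378) proved Prop. 10 modulo five Prop-8 inputs taken as hypotheses; B-p04 (g33)'s ★ `UnitaryThreePHTowerPackage` (p841374) proves all
five in the same binder text: `index_flickerHK_subgroupOf_flickerPH_eq_one` (`m = 0`), `index_flickerHK_subgroupOf_flickerPH_eq` (`[P_H : P_H ∩ H^K_m] = (q²−1)q^{4m−2}`),
`inf_flickerHK_le_flickerPH0` (`P_H ∩ H^K_m ≤ N₀`), `finite_quotient_flickerHK`, `natCard_fibre_flickerPHRho_eq` (fibres of `ρ_m` have `q^m` elements).  This file plugs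
them in: **`natCard_cosets_eq_iTen_of_package`** — FLICKER'S PROP. 10 with only the σ-defect bound `hσd` (from ★ `map_ratio_sub_ratio` at the eigenvalues) and the
unramifiedness∕residue-field data `hσO`, `ha₀`, `hq` left as inputs, all of which (F12) discharges at `K = L_w`.
HONEST LABEL: HC_CM is proved only modulo the printed citations until rung 0 closes; this file is a 20-line junction.

## References
* [Flicker1998UnitaryFL] Y. Z. Flicker, *Elementary proof of the fundamental lemma for a unitary group*, Canad. J. Math. 50 (1998), 74–98: Prop. 10 pp. 85–86, Prop. 8 p. 84.
* [Rogawski1990] J. D. Rogawski, *Automorphic Representations of Unitary Groups in Three Variables* (1990), §4.9 p. 55.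
-/

set_option autoImplicit false

open scoped MatrixGroups WithZero Valued
open Matrix

namespace Literature.NumberTheory.Automorphic

namespace UnitaryGroup

open Literature.NumberTheory.Automorphic.HermitianLattice (unitaryInt mem_unitaryInt_iff LocalConjDatum)
open Literature.NumberTheory.Rogawski1990.Flicker1998 (iTen)
open IsLocalRing

variable {K : Type*} [Field K] [Valued K ℤᵐ⁰] {ϖ : K} (σ : K →+* K) {J : Matrix (Fin 3) (Fin 3) K}
variable [IsDiscreteValuationRing 𝒪[K]] [Finite (ResidueField 𝒪[K])] [IsAdicComplete (maximalIdeal 𝒪[K]) 𝒪[K]]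

/-- **FLICKER'S PROPOSITION 10** (`j ≥ 1`), Prop. 8's numbers discharged by ★ B-p04's package: for `τ = !![A,0,B₂ϖ^{2j}; 0,b,0; B₂,0,A] ∈ H` with
`|B₂| = |ϖ^ν|`, `|A − b| = |ϖ^{N₊}|`: `#{y ∈ P_H ⧸ (P_H ∩ H^K_m) : y⁻¹ τ y ∈ H^K_m} = iTen q ν N₊ m` (as a rational number), for every `m`.
[cite: Flicker1998UnitaryFL, Prop. 10 pp. 85–86; Prop. 8 p. 84] -/
theorem natCard_cosets_eq_iTen_of_package (hJ : J = (StdForm.antidiagonal 3).over K) (hd : LocalConjDatum σ ϖ)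
    (hσO : ∀ y : 𝒪[K], (σ.comp 𝒪[K].subtype) y ∈ 𝒪[K]) {y : K} (hy : y * σ y = -2)
    {m ν Np j : ℕ} (hj : 1 ≤ j)
    {c um τ : ↥(unitaryGroupOfForm σ J)} (hc : ((c : GL (Fin 3) K) : Matrix (Fin 3) (Fin 3) K) = !![1, 0, 0; 0, -1, 0; 0, 0, 1])
    (hum : ((um : GL (Fin 3) K) : Matrix (Fin 3) (Fin 3) K) = !![ϖ ^ m, y, (ϖ ^ m)⁻¹; 0, 1, -σ y * (ϖ ^ m)⁻¹; 0, 0, (ϖ ^ m)⁻¹])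
    {A B₂ b : K} (hτ : ((τ : GL (Fin 3) K) : Matrix (Fin 3) (Fin 3) K) = !![A, 0, B₂ * ϖ ^ (2 * j); 0, b, 0; B₂, 0, A])
    (hτH : τ ∈ Subgroup.centralizer ({c} : Set ↥(unitaryGroupOfForm σ J)))
    (hB₂ : Valued.v B₂ = Valued.v (ϖ ^ ν)) (hs : Valued.v (A - b) = Valued.v (ϖ ^ Np))
    (hσd : Np = ν → m ≤ ν → ν < 2 * m → Valued.v (σ (2 * (A - b) / B₂) - 2 * (A - b) / B₂) ≤ Valued.v (ϖ ^ (2 * m - ν)))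
    {q : ℕ} (hq : Nat.card (ResidueField 𝒪[K]) = q ^ 2)
    {a₀ : 𝒪[K]} (ha₀ : IsUnit (((σ.comp 𝒪[K].subtype).codRestrict 𝒪[K] hσO) a₀ - a₀)) :
    (Nat.card {w : ↥(flickerPH σ J c) ⧸ (flickerHK σ J c um).subgroupOf (flickerPH σ J c) //
      ((Quotient.out w : ↥(flickerPH σ J c)) : ↥(unitaryGroupOfForm σ J))⁻¹ * τ * (Quotient.out w : ↥(flickerPH σ J c)) ∈ flickerHK σ J c um} : ℚ) =
      iTen q ν Np m := by
  haveI := finite_quotient_flickerHK σ hJ hd hy hσO m hum hc hq ha₀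
  refine natCard_cosets_eq_iTen σ hJ hd hσO hy hj hc hum hτ hτH hB₂ hs hσd hq ha₀ ?_ ?_
    (inf_flickerHK_le_flickerPH0 σ hJ hd hy m hum hc) (natCard_fibre_flickerPHRho_eq σ hJ hd hy hσO m hum hc hq ha₀)
  · rintro rfl
    exact index_flickerHK_subgroupOf_flickerPH_eq_one σ hJ hd hy hσO hum hc hq ha₀
  · intro hm
    exact index_flickerHK_subgroupOf_flickerPH_eq σ hJ hd hy hσO hm hum hc hq ha₀

end UnitaryGroup

end Literature.NumberTheory.Automorphic
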